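import Summits.QuantumFields.YangMills.Theorems.ColdStartUniversalityLatticeLangevinDoeblinHaar
import Summits.QuantumFields.YangMills.Theorems.ColdStartUniversalityLatticeLangevinHeatKernelPositivity
import HarnessLib

/-!
# Route `ColdStartUniversality` (fixed-cut-off package): the Doeblin minorisation of the SU(2) lattice Langevin kernels in Haar
# form holds at EVERY lattice time `t > 0`

Helper file (seat `ym-line-csu-p1`, g12, free hands).  `doeblin_szz_haar` (g11) gives `c · Haar^{⊗E} ≤ κ_t(z, ·)` for all `z` and
all `t ≥ 2` only, because the `β' = 0` input was `h_2 ≥ 1/2`.  With the strict positivity of the SU(2) heat kernel at all times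
(`…HeatKernelPositivity`: `exists_pos_le_prod_heatKernelSU2`) and the all-times law identity `map_eq_heatKernel_beta_zero_of_pos`
the same two-step argument (ground-state domination `integral_le_of_groundState` at time `t₀`, then Chapman–Kolmogorov) runs
from any `t₀ > 0`:

* `doeblin_beta_zero_haar_of_pos` — at `β' = 0`: for `t > 0` some `c ∈ (0, 1]` with `c · Haar^{⊗E} ≤ κ⁰_t(z, ·)` for all `z`;
* ★ `doeblin_szz_haar_of_pos` — at every `β'`: for `t₀ > 0` some `c ∈ (0, 1]` with `c · Haar^{⊗E} ≤ κ_t(z, ·)` for ALL `z` and ALL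
  `t ≥ t₀`.

What this is for: the TP rung `FixedCutoffOverlap` (LINE 10 harris_hybrid, crux 26986) for SHORT windows `τ < 2 ε_K`, i.e. the
registered `∀ τ > 0` form (file `TransportPerturbationFixedCutoffOverlap`).  THEOREMS ONLY, [folklore]; RECORD-rung R3 plumbing;
no crux, rung or summit is proved here; the Yang–Mills mass gap is NOT proved.
-/

set_option autoImplicit false

noncomputable section

namespace Summit.QuantumFields.YangMills.Theorems.ColdStartUniversality

open MeasureTheory ProbabilityTheory Filter
open scoped NNReal ENNReal BigOperators
open Literature.Probability.Process Literature.MathematicalPhysics.QuantumFieldTheory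
open Literature.MathematicalPhysics.QuantumLattice (fundamentalRep fundamentalLatticeRep)

variable {L : ℕ} [NeZero L]

/-- **Doeblin at `β' = 0`, explicit Haar form, every time `t > 0`**: there is `c ∈ (0, 1]` (a power of the uniform lower bound of
the SU(2) heat kernel at time `t`) with `c · Haar^{⊗E} ≤ κ⁰_t(z, ·)` for every start `z`. [folklore] -/
theorem doeblin_beta_zero_haar_of_pos
    (κ₀ : ℝ≥0 → Kernel (GaugeConfig 3 L (Matrix.specialUnitaryGroup (Fin 2) ℂ))
      (GaugeConfig 3 L (Matrix.specialUnitaryGroup (Fin 2) ℂ)))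
    (hreal₀ : ∀ (t : ℝ≥0) (x : GaugeConfig 3 L (Matrix.specialUnitaryGroup (Fin 2) ℂ))
        (Ω : Type) [MeasurableSpace Ω] (P : Measure Ω) [IsProbabilityMeasure P]
        (W : ℝ≥0 → Ω → (Edge 3 L × NoiseIdx 2 → ℝ)) (hW : IsFlatBrownian W P)
        (U : ℝ≥0 → Ω → GaugeConfig 3 L (Matrix.specialUnitaryGroup (Fin 2) ℂ)),
        (∀ ω, U 0 ω = x) →
        (latticeLangevinDynamics (fundamentalLatticeRep 2) 0).IsSolution (fundamentalRep (Fin 2))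
          hW.natFiltration P W U →
        κ₀ t x = P.map (U t))
    {t : ℝ≥0} (ht : 0 < (t : ℝ)) :
    ∃ c : ℝ, 0 < c ∧ c ≤ 1 ∧ ∀ z : GaugeConfig 3 L (Matrix.specialUnitaryGroup (Fin 2) ℂ),
      ENNReal.ofReal c • (Measure.pi fun _ : Edge 3 L => haarProbability (Matrix.specialUnitaryGroup (Fin 2) ℂ)) ≤ κ₀ t z := by
  classical
  haveI := secondCountableTopology_su2
  haveI := borelSpace_config L
  haveI : IsProbabilityMeasure (haarProbability (Matrix.specialUnitaryGroup (Fin 2) ℂ)) := inferInstance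
  obtain ⟨c, hc, hc1, hlow⟩ := exists_pos_le_prod_heatKernelSU2 ht (Edge 3 L)
  refine ⟨c ^ Fintype.card (Edge 3 L), pow_pos hc _, pow_le_one₀ hc.le hc1, fun z => ?_⟩
  haveI := isProbabilityMeasure_piWiener (Edge 3 L × NoiseIdx 2)
  have hWc := isFlatBrownian_piWiener 3 L (NoiseIdx 2)
  obtain ⟨Uc, G, hUc, -, -, -, -⟩ := exists_regularFlow L 0 hWc
  rw [hreal₀ t z _ _ _ hWc (Uc z) (hUc z).1 (hUc z).2,
    map_eq_heatKernel_beta_zero_of_pos ht z hWc (hUc z).1 (hUc z).2, ← withDensity_const]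
  refine withDensity_mono (Filter.Eventually.of_forall fun y => ?_)
  exact ENNReal.ofReal_le_ofReal (hlow z y)

/-- ★ **Doeblin for the SZZ kernels, explicit Haar form, all lattice times `t ≥ t₀ > 0`**: at every coupling `β'` and every `t₀ > 0`
there is `c ∈ (0, 1]` with `c · Haar^{⊗E} ≤ κ_t(z, ·)` for every start `z` and every `t ≥ t₀` (ground-state domination of the
`β' = 0` kernels at `t₀`, `doeblin_beta_zero_haar_of_pos`, then Chapman–Kolmogorov). [folklore] -/
theorem doeblin_szz_haar_of_pos (β' : ℝ)
    (κ : ℝ≥0 → Kernel (GaugeConfig 3 L (Matrix.specialUnitaryGroup (Fin 2) ℂ))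
      (GaugeConfig 3 L (Matrix.specialUnitaryGroup (Fin 2) ℂ))) [∀ t, IsMarkovKernel (κ t)]
    (hreal : ∀ (t : ℝ≥0) (x : GaugeConfig 3 L (Matrix.specialUnitaryGroup (Fin 2) ℂ))
        (Ω : Type) [MeasurableSpace Ω] (P : Measure Ω) [IsProbabilityMeasure P]
        (W : ℝ≥0 → Ω → (Edge 3 L × NoiseIdx 2 → ℝ)) (hW : IsFlatBrownian W P)
        (U : ℝ≥0 → Ω → GaugeConfig 3 L (Matrix.specialUnitaryGroup (Fin 2) ℂ)),
        (∀ ω, U 0 ω = x) →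
        (latticeLangevinDynamics (fundamentalLatticeRep 2) β').IsSolution (fundamentalRep (Fin 2))
          hW.natFiltration P W U →
        κ t x = P.map (U t))
    {t₀ : ℝ≥0} (ht₀ : 0 < (t₀ : ℝ)) :
    ∃ c : ℝ, 0 < c ∧ c ≤ 1 ∧ ∀ (z : GaugeConfig 3 L (Matrix.specialUnitaryGroup (Fin 2) ℂ)) (t : ℝ≥0), t₀ ≤ t →
      ENNReal.ofReal c • (Measure.pi fun _ : Edge 3 L => haarProbability (Matrix.specialUnitaryGroup (Fin 2) ℂ)) ≤ κ t z := by
  classical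
  haveI := secondCountableTopology_su2
  haveI := borelSpace_config L
  haveI : IsProbabilityMeasure (haarProbability (Matrix.specialUnitaryGroup (Fin 2) ℂ)) := inferInstance
  set H : Measure (GaugeConfig 3 L (Matrix.specialUnitaryGroup (Fin 2) ℂ)) :=
    Measure.pi fun _ : Edge 3 L => haarProbability (Matrix.specialUnitaryGroup (Fin 2) ℂ) with hH
  haveI : IsProbabilityMeasure H := by rw [hH]; infer_instance
  obtain ⟨κ₀, hκ₀, -, hreal₀⟩ := exists_transitionKernel L 0
  haveI := hκ₀
  -- the two regular flows on the product Wiener space and the ground-state comparison at `t₀`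
  haveI := isProbabilityMeasure_piWiener (Edge 3 L × NoiseIdx 2)
  have hWc := isFlatBrownian_piWiener 3 L (NoiseIdx 2)
  obtain ⟨X, GX, hX, hXm, -, -, -⟩ := exists_regularFlow L β' hWc
  obtain ⟨Y, GY, hY, hYm, -, -, -⟩ := exists_regularFlow L 0 hWc
  obtain ⟨K, Mψ, hcore, -⟩ := integral_le_of_groundState (L := L) β' hWc X hX hXm hWc Y hY hYm
    (f := fun _ => (0 : ℝ)) continuous_const (fun _ => le_rfl) (fun _ => zero_le_one) (fun _ => 1) t₀
  set cst : ℝ := Real.exp (-(K * t₀) - Mψ) with hcst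
  have hcpos : 0 < cst := Real.exp_pos _
  obtain ⟨c₀, hc₀, hc₀1, hmin₀⟩ := doeblin_beta_zero_haar_of_pos (L := L) κ₀ hreal₀ ht₀
  set c : ℝ := cst * c₀ with hc
  have hc0 : 0 < c := mul_pos hcpos hc₀
  -- minorisation at time `t₀`
  have h2 : ∀ z, ENNReal.ofReal c • H ≤ κ t₀ z := by
    intro z
    have hdom : (ENNReal.ofReal cst) • κ₀ t₀ z ≤ κ t₀ z := by
      rw [hreal t₀ z _ _ _ hWc (X z) (hX z).1 (hX z).2, hreal₀ t₀ z _ _ _ hWc (Y z) (hY z).1 (hY z).2]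
      have hmX : Measurable (X z t₀) := ((hX z).2.adapted t₀).mono (hWc.natFiltration.le t₀) le_rfl
      have hmY : Measurable (Y z t₀) := ((hY z).2.adapted t₀).mono (hWc.natFiltration.le t₀) le_rfl
      refine smul_measure_le_of_forall_integral_le hcpos.le fun f hf h0 h1 => ?_
      rw [integral_map hmY.aemeasurable hf.aestronglyMeasurable, integral_map hmX.aemeasurable hf.aestronglyMeasurable]
      exact hcore f hf h0 h1 z t₀
    have h0 := hmin₀ z
    rw [← hH] at h0
    calc ENNReal.ofReal c • H = (ENNReal.ofReal cst) • (ENNReal.ofReal c₀ • H) := by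
          rw [smul_smul, ← ENNReal.ofReal_mul hcpos.le]
      _ ≤ (ENNReal.ofReal cst) • κ₀ t₀ z := by
          rw [Measure.le_iff] at h0 ⊢
          intro s hs
          simp only [Measure.smul_apply, smul_eq_mul]
          exact mul_le_mul' le_rfl (by simpa only [Measure.smul_apply, smul_eq_mul] using h0 s hs)
      _ ≤ κ t₀ z := hdom
  -- `c ≤ 1`
  have hc1 : c ≤ 1 := by
    obtain ⟨z⟩ : Nonempty (GaugeConfig 3 L (Matrix.specialUnitaryGroup (Fin 2) ℂ)) := ⟨fun _ => 1⟩
    have h := (Measure.le_iff'.1 (h2 z)) Set.univ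
    simp only [Measure.smul_apply, measure_univ, smul_eq_mul, mul_one] at h
    have h' : ENNReal.ofReal c ≤ ENNReal.ofReal 1 := by simpa using h
    exact (ENNReal.ofReal_le_ofReal_iff zero_le_one).1 h'
  refine ⟨c, hc0, hc1, fun z t ht => ?_⟩
  -- propagation to `t ≥ t₀` by Chapman–Kolmogorov
  have hsplit : t = (t - t₀) + t₀ := (tsub_add_cancel_of_le ht).symm
  have hck : κ t z = (κ (t - t₀) z).bind (κ t₀) := by
    rw [hsplit, chapmanKolmogorov_szz β' κ hreal (t - t₀) t₀, Kernel.comp_apply]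
    congr 1
    rw [← hsplit]
  rw [hck, Measure.le_iff]
  intro s hs
  rw [Measure.bind_apply hs (κ t₀).measurable.aemeasurable]
  calc (ENNReal.ofReal c • H) s = ∫⁻ _y, (ENNReal.ofReal c • H) s ∂(κ (t - t₀) z) := by
        rw [lintegral_const, measure_univ, mul_one]
    _ ≤ ∫⁻ y, κ t₀ y s ∂(κ (t - t₀) z) := lintegral_mono fun y => Measure.le_iff'.1 (h2 y) s

end Summit.QuantumFields.YangMills.Theorems.ColdStartUniversality

end
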